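import Mathlib.Algebra.BigOperators.Ring.Finset
import Mathlib.Data.Finsupp.Basic
import Literature.ModelTheory.FiniteModelTheory.CohomologicalConsistency
import HarnessLib

/-!
# Cohomological `k`-consistency from marginal-consistent integral weights
# (Conneryd–Ghannane–Pang 2025, Lemmas 3.1 and 4.4, packaged over Ó Conghaile's Definition 5)

Topic `Literature/ModelTheory/FiniteModelTheory`; a PROVED interface lemma on the way to the named
fact `connerydGhannanePang2025_thm_6_1` (`CohomologicalConsistencyThreeColouring.lean`), usable by
every lower bound for the cohomological `k`-consistency algorithm obtained from integral
pseudo-reduction operators (arXiv:2511.17272 §3–§4; also their Theorem 7.4 = Chan–Ng 2025).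

## The mathematics

Conneryd–Ghannane–Pang obtain acceptance by the cohomological `k`-consistency algorithm
(`CohomologicallyKConsistent`, Ó Conghaile's Definition 5, greatest fixpoint of `(·)^{ℤ↓}`) from an
integral pseudo-reduction operator `R` on `ℤ[𝐱_{A,B}]` as follows (Lemma 3.1 and the proof of
Lemma 4.4).  The polynomials `ρ_U(ψ) := R(m_ψ)` attached to the partial maps `ψ : U → B`
* vanish unless `ψ` is a partial homomorphism (`m_ψ` is then a multiple of a monomial axiom);
* satisfy the ONE-STEP MARGINAL IDENTITY `∑_{b ∈ B} ρ_U(ψ[a ↦ b]) = ρ_{U∖a}(ψ)`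
  (from `R((∑_b x_{a,b} - 1)·m_ψ) = 0`), whence, by iteration, all the `ℤ`-affine consistency
  equations `∑_{θ|_D = χ} ρ_U(θ) = ρ_D(χ)` (`marginal_eq_of_forall_erase`);
* and every `φ : C → B` with `ρ_C(φ) ≠ 0` is SEPARATED from the other `ψ : C → B` by a `ℤ`-linear
  functional `h` (`h = eval_y` for `y` the indicator vector of a homomorphism on `cl(C)` extending
  `φ`: `h(ρ_C φ) = 1`, `h(ρ_C ψ) = 0` for `ψ ≠ φ`).
Composing with `h` gives `ℤ`-linear sections `r_U := h ∘ ρ_U` supported in `κ_R = {ρ ≠ 0}` with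
`r_C = 1·φ`; so `κ_R` is a non-empty self-supporting family and the algorithm accepts
(Ó Conghaile, Observation 22 = `SectionSystem.gfp_nonempty_iff`).

## Lean rendering

Weights take values in an arbitrary additive group `M` (`ρ : (U : Finset A) → (↥U → B) → M`);
`ψ[a ↦ b]` is `SectionSystem.extendAt` (from `U.erase a` to `U`), the push-forward along
restriction is `SectionSystem.marginal`, the family `κ_R` is `SectionSystem.weightSystem k ρ`.
Main results: `SectionSystem.zext_weightSystem_of_separated` (a separated section is
`ℤ`-extendable in `κ_R`), `SectionSystem.gfp_nonempty_of_marginals` (acceptance from any start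
system `S₀` containing `κ_R`), and the structure / simple-graph forms
`cohomologicallyKConsistent_of_marginals`, `graphCohomologicallyKConsistent_of_marginals`.

NOT here: the polynomial side (pseudo-reduction operators, closures, the lex-game integrality
Lemma 5.3) that produces such weights — see `CohomologicalConsistencyThreeColouringProofs.lean`
for the state of the formalisation of Theorem 6.1.

## References

* [ConnerydGhannanePang2025] J. Conneryd, Y. Ghannane, S. Pang, Lower Bounds for CSP Hierarchies
  Through Ideal Reduction, arXiv:2511.17272 (SODA 2026), Lemma 3.1, Lemma 4.4. READ.
* [OConghaile2022] A. Ó Conghaile, Cohomology in Constraint Satisfaction and Structure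
  Isomorphism, MFCS 2022, Observation 22.
-/

namespace Literature.ModelTheory.FiniteModelTheory

open Finset

section Marginals

namespace SectionSystem

variable {A : Type*} {B : Type*} [DecidableEq A]

/-- Extend a section over `U.erase a` to `U` by the value `b` at `a` (the partial map `ψ[a ↦ b]`).
[folklore] -/
def extendAt {U : Finset A} {a : A} (ψ : ↥(U.erase a) → B) (b : B) : ↥U → B :=
  fun x => if hx : (x : A) = a then b else ψ ⟨x, Finset.mem_erase.2 ⟨hx, x.2⟩⟩

/-- `ψ[a ↦ b]` takes the value `b` at `a`. [folklore] -/
theorem extendAt_apply_self {U : Finset A} {a : A} (ha : a ∈ U) (ψ : ↥(U.erase a) → B) (b : B) :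
    extendAt ψ b ⟨a, ha⟩ = b :=
  dif_pos rfl

/-- `ψ[a ↦ b]` agrees with `ψ` off `a`. [folklore] -/
theorem extendAt_apply_of_ne {U : Finset A} {a : A} (ψ : ↥(U.erase a) → B) (b : B) (x : ↥U)
    (hx : (x : A) ≠ a) : extendAt ψ b x = ψ ⟨x, Finset.mem_erase.2 ⟨hx, x.2⟩⟩ :=
  dif_neg hx

/-- Restricting `ψ[a ↦ b]` to a context avoiding `a` forgets `b`. [folklore] -/
theorem restrict_extendAt {U D : Finset A} {a : A} (hD : D ⊆ U.erase a) (hDU : D ⊆ U)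
    (ψ : ↥(U.erase a) → B) (b : B) :
    SectionSystem.restrict hDU (extendAt ψ b) = SectionSystem.restrict hD ψ := by
  funext x
  have hx : ((⟨x, hDU x.2⟩ : ↥U) : A) ≠ a := (Finset.mem_erase.1 (hD x.2)).1
  rw [restrict_apply, extendAt_apply_of_ne ψ b _ hx]
  rfl

/-- Sections over `U` correspond to pairs (section over `U ∖ {a}`, value at `a`) for `a ∈ U`.
[folklore] -/
def extendAtEquiv {U : Finset A} {a : A} (ha : a ∈ U) : (↥(U.erase a) → B) × B ≃ (↥U → B) where
  toFun p := extendAt p.1 p.2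
  invFun θ := (SectionSystem.restrict (U.erase_subset a) θ, θ ⟨a, ha⟩)
  left_inv p := by
    refine Prod.ext ?_ (extendAt_apply_self ha p.1 p.2)
    funext x
    have hx : ((⟨x, U.erase_subset a x.2⟩ : ↥U) : A) ≠ a := (Finset.mem_erase.1 x.2).1
    change extendAt p.1 p.2 ⟨x, _⟩ = p.1 x
    rw [extendAt_apply_of_ne p.1 p.2 _ hx]
  right_inv θ := by
    funext x
    change extendAt (SectionSystem.restrict (U.erase_subset a) θ) (θ ⟨a, ha⟩) x = θ x
    by_cases hx : (x : A) = a
    · rcases x with ⟨x, hxU⟩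
      cases hx
      exact extendAt_apply_self hxU _ _
    · rw [extendAt_apply_of_ne _ _ x hx]
      rfl

variable [Fintype B] [DecidableEq B] {M : Type*} [AddCommMonoid M]

/-- The MARGINAL (push-forward along restriction) of a weight function on the sections over `U`
to the sections over `D ⊆ U`: `χ ↦ ∑_{θ|_D = χ} g(θ)`. [folklore] -/
def marginal {D U : Finset A} (h : D ⊆ U) (g : (↥U → B) → M) (χ : ↥D → B) : M :=
  ∑ θ ∈ Finset.univ.filter (fun θ : ↥U → B => SectionSystem.restrict h θ = χ), g θ

/-- The marginal along the identity is the identity. [folklore] -/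
theorem marginal_self {U : Finset A} (h : U ⊆ U) (g : (↥U → B) → M) (χ : ↥U → B) :
    marginal h g χ = g χ := by
  unfold marginal
  simp_rw [restrict_self]
  rw [Finset.filter_eq' Finset.univ χ, if_pos (Finset.mem_univ χ), Finset.sum_singleton]

/-- ONE ELIMINATION STEP: marginalising from `U` to `D ⊆ U ∖ {a}` is marginalising the fibre sums
`ψ ↦ ∑_b g(ψ[a ↦ b])` from `U ∖ {a}`. [folklore] -/
theorem marginal_eq_marginal_erase {U D : Finset A} {a : A} (ha : a ∈ U) (hD : D ⊆ U.erase a)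
    (hDU : D ⊆ U) (g : (↥U → B) → M) (χ : ↥D → B) :
    marginal hDU g χ = marginal hD (fun ψ => ∑ b : B, g (extendAt ψ b)) χ := by
  unfold marginal
  rw [Finset.sum_filter, Finset.sum_filter, ← Fintype.sum_equiv (extendAtEquiv ha) _ _ fun _ => rfl,
    Fintype.sum_prod_type]
  refine Finset.sum_congr rfl fun ψ _ => ?_
  simp only [extendAtEquiv, Equiv.coe_fn_mk, restrict_extendAt hD hDU]
  split_ifs <;> simp

variable (k : ℕ) (ρ : (U : Finset A) → (↥U → B) → M)

/-- ITERATED MARGINALS (the `ℤ`-affine consistency equations of Lemma 3.1 as identities in `M`):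
if the weights satisfy the one-step marginal identity `∑_b ρ_U(ψ[a ↦ b]) = ρ_{U∖a}(ψ)` on all
contexts of size `≤ k`, then `∑_{θ|_D = χ} ρ_U(θ) = ρ_D(χ)` for all `D ⊆ U`, `|U| ≤ k`.
[cite: ConnerydGhannanePang2025, Lemma 3.1] -/
theorem marginal_eq_of_forall_erase
    (hmarg : ∀ (U : Finset A) (a : A), a ∈ U → U.card ≤ k →
      ∀ ψ : ↥(U.erase a) → B, ∑ b : B, ρ U (extendAt ψ b) = ρ (U.erase a) ψ)
    (U D : Finset A) (hDU : D ⊆ U) (hU : U.card ≤ k) (χ : ↥D → B) :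
    marginal hDU (ρ U) χ = ρ D χ := by
  induction U using Finset.strongInduction generalizing D with
  | H U ih =>
    by_cases hDeq : D = U
    · subst hDeq
      exact marginal_self hDU (ρ D) χ
    · obtain ⟨a, haU, haD⟩ := Finset.exists_of_ssubset (lt_of_le_of_ne hDU hDeq)
      have hD : D ⊆ U.erase a :=
        fun x hx => Finset.mem_erase.2 ⟨fun hxa => haD (hxa ▸ hx), hDU hx⟩
      rw [marginal_eq_marginal_erase haU hD hDU]
      have hfun : (fun ψ : ↥(U.erase a) → B => ∑ b : B, ρ U (extendAt ψ b)) = ρ (U.erase a) :=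
        funext fun ψ => hmarg U a haU hU ψ
      rw [hfun]
      exact ih (U.erase a) (Finset.erase_ssubset haU) D hD ((Finset.card_erase_le).trans hU) χ

/-- The family CUT OUT BY THE WEIGHTS: the sections over contexts of size `≤ k` with non-zero
weight (`κ_R = {φ : R(m_φ) ≠ 0}` in the source). [cite: ConnerydGhannanePang2025, §3] -/
def weightSystem : SectionSystem A B :=
  fun U => {ψ | U.card ≤ k ∧ ρ U ψ ≠ 0}

/-- Push-forward of a finitely supported function given by a function on a finite type is the
fibrewise sum. [folklore] -/
theorem mapDomain_equivFunOnFinite_symm_apply {X Y : Type*} [Fintype X] [DecidableEq Y]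
    (f : X → Y) (g : X → ℤ) (y : Y) :
    Finsupp.mapDomain f (Finsupp.equivFunOnFinite.symm g) y =
      ∑ x ∈ Finset.univ.filter (fun x => f x = y), g x := by
  classical
  rw [Finsupp.mapDomain, Finsupp.sum_fintype _ _ fun _ => Finsupp.single_zero _,
    Finsupp.finsetSum_apply, Finset.sum_filter]
  refine Finset.sum_congr rfl fun x _ => ?_
  rw [Finsupp.single_apply, Finsupp.coe_equivFunOnFinite_symm]

variable {M' : Type*} [AddCommGroup M'] (ρ' : (U : Finset A) → (↥U → B) → M')

/-- **From integral marginal-consistent weights to `ℤ`-extendability** (the packaging step of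
Conneryd–Ghannane–Pang, Lemma 3.1 with the last paragraph of the proof of Lemma 4.4): if
`M`-valued weights `ρ_U(ψ)` on the sections satisfy the one-step marginal identity on contexts of
size `≤ k`, and `φ` over `C`, `|C| ≤ k`, is separated from the other sections over `C` by an
additive map `h : M → ℤ` (`h(ρ_C φ) = 1`, `h(ρ_C ψ) = 0` for `ψ ≠ φ`), then `φ` is `ℤ`-extendable
in the family of non-zero weights, by the `ℤ`-linear section `r_U = h ∘ ρ_U`.
[cite: ConnerydGhannanePang2025, Lemma 3.1 and proof of Lemma 4.4] -/
theorem zext_weightSystem_of_separated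
    (hmarg : ∀ (U : Finset A) (a : A), a ∈ U → U.card ≤ k →
      ∀ ψ : ↥(U.erase a) → B, ∑ b : B, ρ' U (extendAt ψ b) = ρ' (U.erase a) ψ)
    {C : Finset A} (hC : C.card ≤ k) {φ : ↥C → B} (h : M' →+ ℤ) (h1 : h (ρ' C φ) = 1)
    (h0 : ∀ ψ : ↥C → B, ψ ≠ φ → h (ρ' C ψ) = 0) :
    ZExt k (weightSystem k ρ') C φ := by
  classical
  refine ⟨fun U => if U.card ≤ k then Finsupp.equivFunOnFinite.symm (fun ψ => h (ρ' U ψ)) else 0,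
    ⟨?_, ?_⟩, ?_⟩
  · intro U t ht
    dsimp only at ht
    by_cases hU : U.card ≤ k
    · rw [if_pos hU, Finsupp.coe_equivFunOnFinite_symm] at ht
      exact ⟨hU, fun h0' => ht (by rw [h0', map_zero])⟩
    · rw [if_neg hU] at ht
      exact (ht rfl).elim
  · intro D U hDU hU
    have hD : D.card ≤ k := (Finset.card_le_card hDU).trans hU
    dsimp only
    rw [if_pos hU, if_pos hD]
    ext χ
    rw [mapDomain_equivFunOnFinite_symm_apply, Finsupp.coe_equivFunOnFinite_symm,
      ← map_sum]
    exact congrArg h (marginal_eq_of_forall_erase k ρ' hmarg U D hDU hU χ)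
  · dsimp only
    rw [if_pos hC]
    ext ψ
    rw [Finsupp.coe_equivFunOnFinite_symm, Finsupp.single_apply]
    by_cases hψ : φ = ψ
    · subst hψ; rw [if_pos rfl, h1]
    · rw [if_neg hψ, h0 ψ (Ne.symm hψ)]

/-- **Lemma 3.1 / 4.4, abstract form: marginal-consistent, point-separated integral weights are
accepted.**  Let `ρ_U(ψ) ∈ M` (`M` an abelian group) be weights on the sections `ψ : U → B`
such that (i) non-zero weight in a context of size `≤ k` implies membership in the start system
`S₀` (e.g. `𝓗_k(A,B)`: `R(m_ψ) = 0` unless `ψ` is a partial homomorphism), (ii) the one-step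
marginal identity holds on contexts of size `≤ k`, and (iii) every `φ` of non-zero weight over a
context `C`, `|C| ≤ k`, is separated from the other sections over `C` by an additive `h : M → ℤ`.
If some section over a context of size `≤ k` has non-zero weight, the greatest fixpoint of
`(·)^{ℤ↓}` from `S₀` is non-empty, i.e. the cohomological `k`-consistency algorithm accepts.
(The non-zero-weight family is self-supporting: `ℤ`-extendability by
`zext_weightSystem_of_separated`, forth and restriction-closure by Observation 22.)
[cite: ConnerydGhannanePang2025, Lemmas 3.1 and 4.4] -/
theorem gfp_nonempty_of_marginals (S₀ : SectionSystem A B)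
    (hS₀ : ∀ (U : Finset A) (ψ : ↥U → B), U.card ≤ k → ρ' U ψ ≠ 0 → ψ ∈ S₀ U)
    (hmarg : ∀ (U : Finset A) (a : A), a ∈ U → U.card ≤ k →
      ∀ ψ : ↥(U.erase a) → B, ∑ b : B, ρ' U (extendAt ψ b) = ρ' (U.erase a) ψ)
    (hsep : ∀ (C : Finset A) (φ : ↥C → B), C.card ≤ k → ρ' C φ ≠ 0 →
      ∃ h : M' →+ ℤ, h (ρ' C φ) = 1 ∧ ∀ ψ : ↥C → B, ψ ≠ φ → h (ρ' C ψ) = 0)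
    (hne : ∃ (C : Finset A) (φ : ↥C → B), C.card ≤ k ∧ ρ' C φ ≠ 0) :
    (gfp k S₀).Nonempty := by
  obtain ⟨C, φ, hC, hφ⟩ := hne
  refine gfp_nonempty_iff.2 ⟨weightSystem k ρ', fun U ψ hψ => hS₀ U ψ hψ.1 hψ.2, ⟨C, φ, hC, hφ⟩,
    isSelfSupporting_iff_zext.2 fun C' φ' hφ' => ?_⟩
  obtain ⟨h, h1, h0⟩ := hsep C' φ' hφ'.1 hφ'.2
  exact zext_weightSystem_of_separated k ρ' hmarg hφ'.1 h h1 h0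

end SectionSystem

/-- **Structures**: marginal-consistent, point-separated integral weights vanishing off the partial
homomorphisms make `A →^ℤ_k B` (Definition 5) hold. [cite: ConnerydGhannanePang2025, Lemma 4.4] -/
theorem cohomologicallyKConsistent_of_marginals (L : FirstOrder.Language) (k : ℕ) (A : Type*)
    (B : Type*) [L.Structure A] [L.Structure B] [DecidableEq A] [Fintype B] [DecidableEq B]
    {M : Type*} [AddCommGroup M] (ρ : (U : Finset A) → (↥U → B) → M)
    (hhom : ∀ (U : Finset A) (ψ : ↥U → B), U.card ≤ k → ρ U ψ ≠ 0 → IsPartialHom L ψ)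
    (hmarg : ∀ (U : Finset A) (a : A), a ∈ U → U.card ≤ k →
      ∀ ψ : ↥(U.erase a) → B, ∑ b : B, ρ U (SectionSystem.extendAt ψ b) = ρ (U.erase a) ψ)
    (hsep : ∀ (C : Finset A) (φ : ↥C → B), C.card ≤ k → ρ C φ ≠ 0 →
      ∃ h : M →+ ℤ, h (ρ C φ) = 1 ∧ ∀ ψ : ↥C → B, ψ ≠ φ → h (ρ C ψ) = 0)
    (hne : ∃ (C : Finset A) (φ : ↥C → B), C.card ≤ k ∧ ρ C φ ≠ 0) :
    CohomologicallyKConsistent L k A B :=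
  SectionSystem.gfp_nonempty_of_marginals k ρ (homSystem L k A B)
    (fun U ψ hU hψ => ⟨hU, hhom U ψ hU hψ⟩) hmarg hsep hne

/-- **Graphs**: marginal-consistent, point-separated integral weights vanishing off the partial
graph homomorphisms make `G →^ℤ_k H` hold; with `H = K₃` this is the form in which Theorem 6.1 is
concluded from the pseudo-reduction operator of §6. [cite: ConnerydGhannanePang2025, Lemma 4.4] -/
theorem graphCohomologicallyKConsistent_of_marginals {V W : Type*} [DecidableEq V] [Fintype W]
    [DecidableEq W] (k : ℕ) (G : SimpleGraph V) (H : SimpleGraph W) {M : Type*} [AddCommGroup M]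
    (ρ : (U : Finset V) → (↥U → W) → M)
    (hhom : ∀ (U : Finset V) (ψ : ↥U → W), U.card ≤ k → ρ U ψ ≠ 0 →
      ∀ u v : ↥U, G.Adj u v → H.Adj (ψ u) (ψ v))
    (hmarg : ∀ (U : Finset V) (a : V), a ∈ U → U.card ≤ k →
      ∀ ψ : ↥(U.erase a) → W, ∑ b : W, ρ U (SectionSystem.extendAt ψ b) = ρ (U.erase a) ψ)
    (hsep : ∀ (C : Finset V) (φ : ↥C → W), C.card ≤ k → ρ C φ ≠ 0 →
      ∃ h : M →+ ℤ, h (ρ C φ) = 1 ∧ ∀ ψ : ↥C → W, ψ ≠ φ → h (ρ C ψ) = 0)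
    (hne : ∃ (C : Finset V) (φ : ↥C → W), C.card ≤ k ∧ ρ C φ ≠ 0) :
    GraphCohomologicallyKConsistent k G H :=
  SectionSystem.gfp_nonempty_of_marginals k ρ (graphHomSystem k G H)
    (fun U ψ hU hψ => ⟨hU, hhom U ψ hU hψ⟩) hmarg hsep hne

end Marginals

end Literature.ModelTheory.FiniteModelTheory
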